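import Literature.IUT.HodgeArakelov.ThetaSettingHextGeometricCoreAtModelTate
import HarnessLib

/-!
# `hextΔ` at the stage-2 Tate model: ONE conjugating element on an open normal core ⟹ the extension `Φ ∈ Aut_top(Γ)`
# (proof-only; K-L6 row «HEXT-DECIDE@modelχq», self-named sub-row «HEXT-ONE-ELEMENT@modelχq», file 1 of 2: the construction)

S. Mochizuki, *The étale theta function and its Frobenioid-theoretic manifestations* [EtTh], Publ. RIMS **45** (2009)
(refereed), §2, Prop. 2.4 p. 38 (every automorphism of `Π^tp_{X̲̲}` arises from one of `Π^tp_X`) [cite: MochizukiEtTh2009, Prop 2.4 p.38];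
§1 p. 12 (`Π^tp_X`, `Δ^tp_X`); Def. 2.5 (i) p. 39 (`X̲̲`); [SemiAnbd] Ex. 3.10 p. 45 («temp-slim») [cite: MochizukiSemiAnbd2006, Ex 3.10 p.45].
Cell `abc-iut`, seat abc-iut-L6-d6 (gen 11).  PROOF-ONLY companion of abc-iut-w5-d169's reduction of record
`ThetaSettingHextReductionAtModelTate` (p497819 / p498683), abc-iut-L6-t13's `ThetaSettingHextGeometricCoreAtModelTate`
(★ `hext_at_iff_exists_gfpAut_extends`) and abc-iut-w5-d111's `SettingModelGfpSlim` (`isSlimGroup_gfp`): NO definition, NO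
instance, NO new named fact; inputs BY NAME.

SETTING.  An `X̲̲`-choice `C` over `modelχq p i j` (`Π^tp_X = Γ ⋊_{actχq} G_{ℚ_p}`, `Γ = F̂₂ ×_Ẑ ℤ = Gfp`, `Δ^tp_X = inl Γ`) whose
`Π^tp_{X̲̲} = C.Huu` is the carrier of record `dUU l ⋊ G_{ℚ_p}` (membership clauses `hinl`/`hleft`, as in p497819); `a := gfpOf (of 0)`
(the tempered loop); for `γ : Π^tp_{X̲̲} ≃ₜ* Π^tp_{X̲̲}` satisfying (Δ)(γ) [«`γ` maps `Δ^tp_X ∩ Π^tp_{X̲̲}` onto itself», i.e.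
`((curveχq).DeltaTemp.subgroupOf C.Huu).map γ = …`; a THEOREM at the Tate record: abc-iut-w4-d044 p488629 / abc-iut-w6-d028 p498716]
its GEOMETRIC PART is `γ̃ d := (γ (inl d)).left` (`d ∈ dUU l`).  The state of record (abc-iut-L6-t13 ★): `hextΔ(γ) ⟺ γ̃` is the
restriction of some `Φ ∈ Aut_top(Γ)`.

WHAT THIS FILE PROVES (EVERY prime `p`, EVERY `i j`, EVERY `X̲̲`-choice of the displayed shape, EVERY `l`).
* §0 `eq_top_of_dUU_le_of_gfpOf_zero_mem` — **`Γ = ⟨dUU l, a⟩` ABSTRACTLY**: every `g ∈ Γ` is `a^s · c^t · d` with `c = ⁅a, b⁆`,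
  `d ∈ dUU l` (`s`, `t` read off `ĥ_l g`), and `b ∈ dUU l`; `ker_levelHom_le_dUU`, `isOpen_ker_levelHom` (the level cores
  `Ker ĥ_N ⊴ Γ` are open, and `Ker ĥ_l ≤ dUU l`).
* §1 `exists_gfpAut_extends_of_exists_conj` — **THE CONSTRUCTION.**  Let `K ⊴ Γ` be ANY open normal subgroup with `K ≤ dUU l`
  (e.g. `Ker ĥ_l`, or a deeper `Ker ĥ_{lM}`).  If (Δ)(γ) holds and SOME `g ∈ Γ` satisfies `γ̃(a n a⁻¹) = g · γ̃(n) · g⁻¹` for all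
  `n ∈ K`, then `γ̃` IS the restriction of a bi-continuous automorphism `Φ` of `Γ` with `Φ a = g` (hence `hextΔ(γ)`, file 2).
  Proof: `S := {x ∈ Γ | ∃ y, ∀ n ∈ K, γ̃(x n x⁻¹) = y γ̃(n) y⁻¹}` is an abstract subgroup containing `dUU l` (`y := γ̃ x`) and `a`
  (`y := g`), so `S = Γ` (§0); `y` is UNIQUE (`isSlimGroup_gfp`: `γ̃(K)` generates an open subgroup); `Φ(x) := y` is a
  homomorphism, `= γ̃` on `dUU l`, injective (slimness again: its kernel centralises `K`), surjective (it permutes the finitely many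
  cosets of `dUU l`, `index_dUU_ne_zero`), continuous with continuous inverse (both agree with the continuous `γ̃`, resp. `γ̃⁻¹`, on
  the open subgroup `dUU l`).
The ★ criterion `hextΔ(γ) ⟺ (Δ)(γ) ∧ ∃ g ∈ Γ, ∀ n ∈ K, γ̃(a n a⁻¹) = g γ̃(n) g⁻¹` is file 2 (`ThetaSettingHextOneElementCriterionAtModelTate`).
CONSEQUENCE (honest words): an EXACT REDUCTION of the same species as the instruments of record ((K1) p496371, R5-1 p496682/p497023);
neither direction of `hextΔ` is claimed; `hextΔ` stays UNDECIDED-AT-MODEL.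

HONEST LABEL. `modelχq` is a SEMI-SYNTHETIC model of the typed [EtTh] §1 interface (not the tempered `π₁` of a curve): a
statement about OUR model and OUR typed binder only; nothing of [EtTh] / [IUTchII] (claim key `Mochizuki2012`, DISPUTED, D-0012)
is asserted; no side is taken on [IUTchIII] Cor. 3.12; typed ≠ proved; nothing here bears on whether abc is proved or refuted.
bears_on: LADDER-ABC:A2.L-K (K-L6 «HEXT-DECIDE@modelχq») → LADDER-FRONTIER F-A2 (M·L6) → rung 0 `Summit.ABC`.
-/

set_option autoImplicit false

noncomputable section

namespace Literature.AnabelianGeometry.EtaleTheta.SettingModel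

open Literature.AnabelianGeometry.SemiGraphs
open Literature.IUT.HodgeArakelov Literature.IUT.HodgeArakelov.EtaleThetaDataOfSetting
open Function
open _root_.Topology
open scoped commutatorElement

/-! ## §0. The level-`l` core `N_l = Ker ĥ_l` and the abstract generation `Γ = ⟨dUU l, a⟩` -/

/-- `N_l = Ker(ĥ_l|_Γ) ≤ dUU l` (the level-`l` core lies in `Π^tp_{X̲̲}`'s geometric part). [cite: MochizukiEtTh2009, Def 2.5 (i) p.39] -/
theorem ker_levelHom_le_dUU (l' : ℕ+) : (levelHom l').ker ≤ dUU l' := fun g hg => by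
  rw [MonoidHom.mem_ker] at hg
  exact (mem_dUU_iff l' g).2 ⟨by rw [hg]; exact Heis.one_x, by rw [hg]; exact Heis.one_z⟩

/-- `N_l = Ker(ĥ_l|_Γ)` is open in `Γ` (`Heis(ℤ/l)` is discrete). [cite: MochizukiEtTh2009, §1 p.13] -/
theorem isOpen_ker_levelHom (l' : ℕ+) : IsOpen (((levelHom l').ker : Subgroup Gfp) : Set Gfp) := by
  rw [MonoidHom.coe_ker]
  exact (isOpen_discrete _).preimage (levelHom_continuous l')

/-- The loop `b = gfpOf (of 1)` lies in `dUU l` (`ĥ_l b = (0, 1, 0)`). [cite: MochizukiEtTh2009, Def 2.5 (i) p.39] -/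
theorem gfpOf_one_mem_dUU (l' : ℕ+) : gfpOf (FreeGroup.of 1) ∈ dUU l' := by
  rw [mem_dUU_iff, levelHom_gfpOf, heisHom_of_one, Heis.map_apply]
  exact ⟨map_zero _, map_zero _⟩

/-- The graph map `g ↦ (η g, expA g)` is multiplicative. [cite: MochizukiEtTh2009, §1 p.12] -/
private theorem gfpOf_mul_aux (g h : F₂) : gfpOf (g * h) = gfpOf g * gfpOf h :=
  Subtype.ext (Prod.ext (map_mul eta g h) (map_mul expA g h))

/-- The graph map commutes with integer powers. [cite: MochizukiEtTh2009, §1 p.12] -/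
private theorem gfpOf_zpow_aux (g : F₂) (k : ℤ) : gfpOf (g ^ k) = gfpOf g ^ k := by
  let φ : F₂ →* Gfp :=
    { toFun := gfpOf
      map_one' := Subtype.ext (Prod.ext (map_one eta) (map_one expA))
      map_mul' := gfpOf_mul_aux }
  exact map_zpow φ g k

/-- **`Γ = ⟨dUU l, a⟩` as an ABSTRACT group**: a subgroup of `Γ` containing `dUU l` and the loop `a = gfpOf (of 0)` is all of
`Γ` — every `g ∈ Γ` is `a^s · c^t · d` with `c = ⁅a, b⁆`, `d ∈ dUU l`, `s`, `t` read off `ĥ_l g`, and `b ∈ dUU l`.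
[cite: MochizukiEtTh2009, Def 2.5 (i) p.39] -/
theorem eq_top_of_dUU_le_of_gfpOf_zero_mem (l' : ℕ+) {S : Subgroup Gfp} (hU : dUU l' ≤ S)
    (ha : gfpOf (FreeGroup.of 0) ∈ S) : S = ⊤ := by
  have hb : gfpOf (FreeGroup.of 1) ∈ S := hU (gfpOf_one_mem_dUU l')
  have hc : gfpOf ⁅FreeGroup.of (0 : Fin 2), FreeGroup.of 1⁆ ∈ S := by
    rw [commutatorElement_def, gfpOf_mul_aux, gfpOf_mul_aux, gfpOf_mul_aux, ← zpow_neg_one, ← zpow_neg_one,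
      gfpOf_zpow_aux, gfpOf_zpow_aux]
    exact S.mul_mem (S.mul_mem (S.mul_mem ha hb) (S.zpow_mem ha _)) (S.zpow_mem hb _)
  rw [eq_top_iff]
  intro g _
  -- peel off `a^s`
  obtain ⟨s, hs⟩ := ZMod.intCast_surjective (levelHom l' g).x
  have hA : levelHom l' (gfpOf (FreeGroup.of 0 ^ s)) = ⟨(s : ZMod l'), 0, 0⟩ := levelHom_gfpOf_of_zero_zpow l' s
  have hAS : gfpOf (FreeGroup.of 0 ^ s) ∈ S := by rw [gfpOf_zpow_aux]; exact S.zpow_mem ha s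
  set g₁ : Gfp := (gfpOf (FreeGroup.of 0 ^ s))⁻¹ * g with hg₁
  have hx₁ : (levelHom l' g₁).x = 0 := by
    rw [hg₁, map_mul, map_inv, Heis.mul_x, Heis.inv_x, hA, hs, neg_add_cancel]
  -- peel off `c^t`
  obtain ⟨t, ht⟩ := ZMod.intCast_surjective (levelHom l' g₁).z
  have hC : levelHom l' (gfpOf (⁅FreeGroup.of (0 : Fin 2), FreeGroup.of 1⁆ ^ t)) = ⟨0, 0, (t : ZMod l')⟩ :=
    levelHom_gfpOf_commutator_zpow l' t
  have hCS : gfpOf (⁅FreeGroup.of (0 : Fin 2), FreeGroup.of 1⁆ ^ t) ∈ S := by rw [gfpOf_zpow_aux]; exact S.zpow_mem hc t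
  set g₂ : Gfp := (gfpOf (⁅FreeGroup.of (0 : Fin 2), FreeGroup.of 1⁆ ^ t))⁻¹ * g₁ with hg₂
  have hg₂U : g₂ ∈ dUU l' := by
    refine (mem_dUU_iff l' g₂).2 ⟨?_, ?_⟩
    · rw [hg₂, map_mul, map_inv, Heis.mul_x, Heis.inv_x, hC, hx₁, neg_zero, add_zero]
    · rw [hg₂, map_mul, map_inv, Heis.mul_z, Heis.inv_z, Heis.inv_x, hC, ht]
      simp only [mul_zero, add_zero, neg_zero, zero_mul, neg_add_cancel]
  have hg : g = gfpOf (FreeGroup.of 0 ^ s) * (gfpOf (⁅FreeGroup.of (0 : Fin 2), FreeGroup.of 1⁆ ^ t) * g₂) := by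
    rw [hg₂, hg₁, mul_inv_cancel_left, mul_inv_cancel_left]
  rw [hg]
  exact S.mul_mem hAS (S.mul_mem hCS (hU hg₂U))


/-! ## §1. The construction: from ONE conjugating element to the automorphism `Φ` of `Γ` -/

variable {p : ℕ} [Fact p.Prime] {i j : ℤ} {hj : Even j} {E : (ThetaSetting.modelχq p i j hj).EtaleThetaData} {l : ℕ}
  (C : E.DoubleUnderline l) {l' : ℕ+}
  (hinl : ∀ d ∈ dUU l', (SemidirectProduct.inl d : PiTpχq p i j) ∈ C.Huu)
  (hinr : ∀ σ : GQp p, (SemidirectProduct.inr σ : PiTpχq p i j) ∈ C.Huu)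
  (hleft : ∀ h ∈ C.Huu, (h : PiTpχq p i j).left ∈ dUU l')

include hinl in
/-- **The geometric part `γ̃` of `γ` and of `γ⁻¹` under (Δ)(γ)**: writing `γ̃ d := (γ (inl d)).left`, `γ̃' e := (γ⁻¹ (inl e)).left`
for `d, e ∈ dUU l`, the clause «`γ` maps `Δ^tp_X ∩ Π^tp_{X̲̲}` onto itself» gives `γ (inl d) = inl (γ̃ d)`, `γ⁻¹ (inl e) = inl (γ̃' e)`,
`γ̃' (γ̃ d) = d`, `γ̃ (γ̃' e) = e`, and `γ̃` is multiplicative with values in `dUU l`.  (Bookkeeping for §1.)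
[cite: MochizukiEtTh2009, Def 2.5 (i) p.39] -/
theorem geometricPart_spec (γ : ↥C.Huu ≃ₜ* ↥C.Huu)
    (hΔ : ((curveχq p i j).DeltaTemp.subgroupOf C.Huu).map γ.toMulEquiv.toMonoidHom =
      (curveχq p i j).DeltaTemp.subgroupOf C.Huu) :
    (∀ (d : Gfp) (hd : d ∈ dUU l'),
        ((γ ⟨SemidirectProduct.inl d, hinl d hd⟩ : C.Huu) : PiTpχq p i j) =
          SemidirectProduct.inl ((γ ⟨SemidirectProduct.inl d, hinl d hd⟩ : C.Huu) : PiTpχq p i j).left) ∧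
    (∀ (d : Gfp) (hd : d ∈ dUU l'),
        ((γ.symm ⟨SemidirectProduct.inl d, hinl d hd⟩ : C.Huu) : PiTpχq p i j) =
          SemidirectProduct.inl ((γ.symm ⟨SemidirectProduct.inl d, hinl d hd⟩ : C.Huu) : PiTpχq p i j).left) := by
  -- membership of `inl d` in `Δ^tp_X ∩ Π^tp_{X̲̲}`
  have hmemΔ : ∀ (d : Gfp) (hd : d ∈ dUU l'),
      (⟨SemidirectProduct.inl d, hinl d hd⟩ : C.Huu) ∈ (curveχq p i j).DeltaTemp.subgroupOf C.Huu := fun d hd => by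
    rw [Subgroup.mem_subgroupOf]
    exact inl_mem_deltaTempχq p i j d
  refine ⟨fun d hd => ?_, fun d hd => ?_⟩
  · have h1 : γ ⟨SemidirectProduct.inl d, hinl d hd⟩ ∈ (curveχq p i j).DeltaTemp.subgroupOf C.Huu :=
      hΔ ▸ ⟨_, hmemΔ d hd, rfl⟩
    exact eq_inl_of_right_eq_oneq p i j ((mem_deltaTempχq_iff p i j _).mp (Subgroup.mem_subgroupOf.mp h1))
  · have h2 : (⟨SemidirectProduct.inl d, hinl d hd⟩ : C.Huu) ∈
        ((curveχq p i j).DeltaTemp.subgroupOf C.Huu).map γ.toMulEquiv.toMonoidHom := hΔ.symm ▸ hmemΔ d hd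
    obtain ⟨y, hy, hyd⟩ := h2
    have hy' : y = γ.symm ⟨SemidirectProduct.inl d, hinl d hd⟩ := by rw [← hyd]; exact (γ.symm_apply_apply y).symm
    exact eq_inl_of_right_eq_oneq p i j ((mem_deltaTempχq_iff p i j _).mp (Subgroup.mem_subgroupOf.mp (hy' ▸ hy)))


include hinl hleft in
/-- **THE CONSTRUCTION (one conjugating element ⟹ an automorphism of `Γ` extending `γ̃`).**  Let `K ⊴ Γ` be any OPEN normal
subgroup contained in `dUU l` (e.g. the level-`l` core `N_l = Ker ĥ_l`, or any deeper level `Ker ĥ_{lM}`), let `γ` satisfy (Δ)(γ),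
and suppose SOME `g ∈ Γ` conjugates like the loop `a` under transport by `γ̃` on `K`: `γ̃(a n a⁻¹) = g · γ̃(n) · g⁻¹` for all
`n ∈ K`.  Then `γ̃` is the restriction to `dUU l` of a bi-continuous automorphism `Φ` of `Γ = F̂₂ ×_Ẑ ℤ`, and `Φ a = g`.
Ingredients: `Γ = ⟨dUU l, a⟩` abstractly (§0), slimness of `Γ` (`isSlimGroup_gfp`, [SemiAnbd] Ex. 3.10), finiteness of
`[Γ : dUU l]` (`index_dUU_ne_zero`). [cite: MochizukiEtTh2009, Prop 2.4 p.38] -/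
theorem exists_gfpAut_extends_of_exists_conj (K : Subgroup Gfp) (hKn : K.Normal) (hKo : IsOpen (K : Set Gfp))
    (hKU : K ≤ dUU l') (γ : ↥C.Huu ≃ₜ* ↥C.Huu)
    (hΔ : ((curveχq p i j).DeltaTemp.subgroupOf C.Huu).map γ.toMulEquiv.toMonoidHom =
      (curveχq p i j).DeltaTemp.subgroupOf C.Huu)
    (g : Gfp)
    (hg : ∀ (n : Gfp) (hn : n ∈ K),
      ((γ ⟨SemidirectProduct.inl (gfpOf (FreeGroup.of 0) * n * (gfpOf (FreeGroup.of 0))⁻¹),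
          hinl _ (hKU (hKn.conj_mem n hn _))⟩ : C.Huu) : PiTpχq p i j).left =
        g * ((γ ⟨SemidirectProduct.inl n, hinl n (hKU hn)⟩ : C.Huu) : PiTpχq p i j).left * g⁻¹) :
    ∃ Φ : Gfp ≃ₜ* Gfp, Φ (gfpOf (FreeGroup.of 0)) = g ∧ ∀ (d : Gfp) (hd : d ∈ dUU l'),
      (SemidirectProduct.inl (Φ d) : PiTpχq p i j) = ((γ ⟨SemidirectProduct.inl d, hinl d hd⟩ : C.Huu) : PiTpχq p i j) := by
  classical
  obtain ⟨hγinl, hγinl'⟩ := geometricPart_spec C hinl γ hΔ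
  /- Step 0: the geometric parts `f = γ̃`, `f' = γ̃⁻¹` as total functions on `Γ` (junk value `1` off `dUU l`). -/
  let f : Gfp → Gfp := fun d =>
    if hd : d ∈ dUU l' then ((γ ⟨SemidirectProduct.inl d, hinl d hd⟩ : C.Huu) : PiTpχq p i j).left else 1
  let f' : Gfp → Gfp := fun d =>
    if hd : d ∈ dUU l' then ((γ.symm ⟨SemidirectProduct.inl d, hinl d hd⟩ : C.Huu) : PiTpχq p i j).left else 1
  have hf : ∀ (d : Gfp) (hd : d ∈ dUU l'),
      f d = ((γ ⟨SemidirectProduct.inl d, hinl d hd⟩ : C.Huu) : PiTpχq p i j).left := fun d hd => dif_pos hd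
  have hf' : ∀ (d : Gfp) (hd : d ∈ dUU l'),
      f' d = ((γ.symm ⟨SemidirectProduct.inl d, hinl d hd⟩ : C.Huu) : PiTpχq p i j).left := fun d hd => dif_pos hd
  have hfinl : ∀ (d : Gfp) (hd : d ∈ dUU l'),
      (SemidirectProduct.inl (f d) : PiTpχq p i j) = ((γ ⟨SemidirectProduct.inl d, hinl d hd⟩ : C.Huu) : PiTpχq p i j) :=
    fun d hd => (hf d hd).symm ▸ (hγinl d hd).symm
  have hf'inl : ∀ (d : Gfp) (hd : d ∈ dUU l'), (SemidirectProduct.inl (f' d) : PiTpχq p i j) =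
      ((γ.symm ⟨SemidirectProduct.inl d, hinl d hd⟩ : C.Huu) : PiTpχq p i j) := fun d hd => (hf' d hd).symm ▸ (hγinl' d hd).symm
  have hfU : ∀ (d : Gfp) (hd : d ∈ dUU l'), f d ∈ dUU l' := fun d hd => by
    have h := hleft _ (γ ⟨SemidirectProduct.inl d, hinl d hd⟩).2
    rwa [← hfinl d hd, SemidirectProduct.left_inl] at h
  have hf'U : ∀ (d : Gfp) (hd : d ∈ dUU l'), f' d ∈ dUU l' := fun d hd => by
    have h := hleft _ (γ.symm ⟨SemidirectProduct.inl d, hinl d hd⟩).2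
    rwa [← hf'inl d hd, SemidirectProduct.left_inl] at h
  have hf'f : ∀ (d : Gfp) (hd : d ∈ dUU l'), f' (f d) = d := fun d hd => by
    apply SemidirectProduct.inl_injective (φ := actχq p i j)
    rw [hf'inl _ (hfU d hd)]
    have h : (⟨SemidirectProduct.inl (f d), hinl _ (hfU d hd)⟩ : C.Huu) = γ ⟨SemidirectProduct.inl d, hinl d hd⟩ :=
      Subtype.ext (hfinl d hd)
    rw [h, γ.symm_apply_apply]
  have hff' : ∀ (d : Gfp) (hd : d ∈ dUU l'), f (f' d) = d := fun d hd => by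
    apply SemidirectProduct.inl_injective (φ := actχq p i j)
    rw [hfinl _ (hf'U d hd)]
    have h : (⟨SemidirectProduct.inl (f' d), hinl _ (hf'U d hd)⟩ : C.Huu) = γ.symm ⟨SemidirectProduct.inl d, hinl d hd⟩ :=
      Subtype.ext (hf'inl d hd)
    rw [h, γ.apply_symm_apply]
  have hfmul : ∀ (d₁ : Gfp) (h₁ : d₁ ∈ dUU l') (d₂ : Gfp) (h₂ : d₂ ∈ dUU l'), f (d₁ * d₂) = f d₁ * f d₂ := by
    intro d₁ h₁ d₂ h₂
    apply SemidirectProduct.inl_injective (φ := actχq p i j)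
    have h : (⟨SemidirectProduct.inl (d₁ * d₂), hinl _ ((dUU l').mul_mem h₁ h₂)⟩ : C.Huu) =
        ⟨SemidirectProduct.inl d₁, hinl d₁ h₁⟩ * ⟨SemidirectProduct.inl d₂, hinl d₂ h₂⟩ :=
      Subtype.ext (map_mul SemidirectProduct.inl d₁ d₂)
    rw [map_mul, hfinl _ ((dUU l').mul_mem h₁ h₂), hfinl _ h₁, hfinl _ h₂, h, map_mul, Subgroup.coe_mul]
  have hfone : f 1 = 1 := by
    have h := hfmul 1 (one_mem _) 1 (one_mem _)
    rw [mul_one] at h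
    have h2 : f 1 * f 1 = f 1 * 1 := by rw [mul_one]; exact h.symm
    exact mul_left_cancel h2
  have hfinv : ∀ (d : Gfp) (hd : d ∈ dUU l'), f d⁻¹ = (f d)⁻¹ := fun d hd => by
    have h := hfmul d hd d⁻¹ ((dUU l').inv_mem hd)
    rw [mul_inv_cancel, hfone] at h
    exact eq_inv_of_mul_eq_one_right h.symm
  have hfinj : ∀ (d₁ : Gfp) (h₁ : d₁ ∈ dUU l') (d₂ : Gfp) (h₂ : d₂ ∈ dUU l'), f d₁ = f d₂ → d₁ = d₂ := by
    intro d₁ h₁ d₂ h₂ h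
    rw [← hf'f d₁ h₁, ← hf'f d₂ h₂, h]
  /- Step 1: continuity of `f`, `f'` on the open subgroup `dUU l`. -/
  have hcontγ : ∀ (δ : ↥C.Huu ≃ₜ* ↥C.Huu),
      Continuous fun d : ↥(dUU l') =>
        ((δ ⟨SemidirectProduct.inl (d : Gfp), hinl d.1 d.2⟩ : C.Huu) : PiTpχq p i j).left := fun δ =>
    (Semidirect.continuous_left (isInducing_leftRightχq p i j)).comp
      (continuous_subtype_val.comp (δ.continuous.comp
        (((continuous_inlχq p i j).comp continuous_subtype_val).subtype_mk _)))
  have hfcont : ContinuousOn f (dUU l' : Set Gfp) := by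
    rw [continuousOn_iff_continuous_restrict]
    have h : (dUU l' : Set Gfp).restrict f = fun d : ↥(dUU l') =>
        ((γ ⟨SemidirectProduct.inl (d : Gfp), hinl d.1 d.2⟩ : C.Huu) : PiTpχq p i j).left := by
      funext d
      exact hf d.1 d.2
    rw [h]
    exact hcontγ γ
  have hf'cont : ContinuousOn f' (dUU l' : Set Gfp) := by
    rw [continuousOn_iff_continuous_restrict]
    have h : (dUU l' : Set Gfp).restrict f' = fun d : ↥(dUU l') =>
        ((γ.symm ⟨SemidirectProduct.inl (d : Gfp), hinl d.1 d.2⟩ : C.Huu) : PiTpχq p i j).left := by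
      funext d
      exact hf' d.1 d.2
    rw [h]
    exact hcontγ γ.symm
  /- Step 2: the transport relation `P x y : ∀ n ∈ N_l, f (x n x⁻¹) = y (f n) y⁻¹` and its uniqueness in `y` (slimness). -/
  have hKn : ∀ (n : Gfp), n ∈ K → ∀ x : Gfp, x * n * x⁻¹ ∈ K := fun n hn x => hKn.conj_mem n hn x
  let P : Gfp → Gfp → Prop := fun x y => ∀ n ∈ K, f (x * n * x⁻¹) = y * f n * y⁻¹
  -- the image `f(N_l)` generates an open subgroup, so its centraliser is trivial
  have hcent : ∀ z : Gfp, (∀ n ∈ K, z * f n = f n * z) → z = 1 := by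
    intro z hz
    let W : Subgroup Gfp := Subgroup.closure (f '' (K : Set Gfp))
    have hWopen : IsOpen (W : Set Gfp) := by
      apply Subgroup.isOpen_of_mem_nhds (g := 1)
      have hO : IsOpen ((dUU l' : Set Gfp) ∩ f' ⁻¹' (K : Set Gfp)) :=
        hf'cont.isOpen_inter_preimage (isOpen_dUU l') hKo
      refine Filter.mem_of_superset (hO.mem_nhds ⟨one_mem _, ?_⟩) ?_
      · show f' 1 ∈ K
        rw [show f' 1 = 1 by simpa only [hfone] using hf'f 1 (one_mem _)]
        exact one_mem _
      · rintro e ⟨he, heK⟩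
        have : e = f (f' e) := (hff' e he).symm
        rw [this]
        exact Subgroup.subset_closure ⟨f' e, heK, rfl⟩
    have hbot := isSlimGroup_gfp.centralizer_eq_bot W hWopen
    have hzW : z ∈ Subgroup.centralizer (W : Set Gfp) := by
      rw [Subgroup.centralizer_closure, Subgroup.mem_centralizer_iff]
      rintro _ ⟨n, hn, rfl⟩
      exact (hz n hn).symm
    exact Subgroup.mem_bot.mp (hbot ▸ hzW)
  have huniq : ∀ x y y' : Gfp, P x y → P x y' → y = y' := by
    intro x y y' hy hy'
    have h := hcent (y'⁻¹ * y) fun n hn => by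
      have e := (hy n hn).symm.trans (hy' n hn)
      -- `y f n y⁻¹ = y' f n y'⁻¹`
      calc y'⁻¹ * y * f n = y'⁻¹ * (y * f n * y⁻¹) * y := by group
        _ = y'⁻¹ * (y' * f n * y'⁻¹) * y := by rw [e]
        _ = f n * (y'⁻¹ * y) := by group
    exact (inv_mul_eq_one.mp h).symm
  /- Step 3: `S := {x | ∃ y, P x y}` is a subgroup containing `dUU l` and `a`, hence all of `Γ` (§0). -/
  have hPone : P 1 1 := fun n _ => by simp only [one_mul, inv_one, mul_one]
  have hPmul : ∀ x y x' y', P x y → P x' y' → P (x * x') (y * y') := by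
    intro x y x' y' h h' n hn
    have e1 : x * x' * n * (x * x')⁻¹ = x * (x' * n * x'⁻¹) * x⁻¹ := by group
    rw [e1, h _ (hKn n hn x'), h' n hn]
    group
  have hPinv : ∀ x y, P x y → P x⁻¹ y⁻¹ := by
    intro x y h n hn
    have e := h _ (hKn n hn x⁻¹)
    have e1 : x * (x⁻¹ * n * x⁻¹⁻¹) * x⁻¹ = n := by group
    rw [e1] at e
    rw [e]
    group
  have hPU : ∀ u ∈ dUU l', P u (f u) := by
    intro u hu n hn
    rw [hfmul _ ((dUU l').mul_mem hu (hKU hn)) _ ((dUU l').inv_mem hu), hfmul _ hu _ (hKU hn), hfinv u hu]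
  have hPa : P (gfpOf (FreeGroup.of 0)) g := fun n hn => by
    show f _ = g * f n * g⁻¹
    rw [hf _ (hKU (hKn n hn _)), hf n (hKU hn)]
    exact hg n hn
  have hS : ∀ x : Gfp, ∃ y, P x y := by
    let S : Subgroup Gfp :=
      { carrier := {x | ∃ y, P x y}
        one_mem' := ⟨1, hPone⟩
        mul_mem' := fun ⟨y, hy⟩ ⟨y', hy'⟩ => ⟨y * y', hPmul _ _ _ _ hy hy'⟩
        inv_mem' := fun ⟨y, hy⟩ => ⟨y⁻¹, hPinv _ _ hy⟩ }
    have hSU : dUU l' ≤ S := fun u hu => ⟨f u, hPU u hu⟩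
    have hStop : S = ⊤ := eq_top_of_dUU_le_of_gfpOf_zero_mem l' hSU ⟨g, hPa⟩
    exact fun x => show x ∈ S from hStop ▸ Subgroup.mem_top x
  /- Step 4: `Φ x :=` the unique `y` with `P x y`; a homomorphism extending `f`, injective, surjective. -/
  let Φf : Gfp → Gfp := fun x => Classical.choose (hS x)
  have hΦP : ∀ x, P x (Φf x) := fun x => Classical.choose_spec (hS x)
  have hΦmul : ∀ x x', Φf (x * x') = Φf x * Φf x' := fun x x' =>
    huniq _ _ _ (hΦP (x * x')) (hPmul _ _ _ _ (hΦP x) (hΦP x'))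
  have hΦone : Φf 1 = 1 := huniq _ _ _ (hΦP 1) hPone
  have hΦU : ∀ u ∈ dUU l', Φf u = f u := fun u hu => huniq _ _ _ (hΦP u) (hPU u hu)
  have hΦa : Φf (gfpOf (FreeGroup.of 0)) = g := huniq _ _ _ (hΦP _) hPa
  let Φm : Gfp →* Gfp := { toFun := Φf, map_one' := hΦone, map_mul' := hΦmul }
  have hΦm : ∀ x, Φm x = Φf x := fun _ => rfl
  have hΦinj : Function.Injective Φm := by
    rw [injective_iff_map_eq_one]
    intro x hx
    rw [hΦm] at hx
    -- `P x 1`: `f (x n x⁻¹) = f n`, so `x` centralises the open subgroup `N_l`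
    have hP1 : P x 1 := hx ▸ hΦP x
    have hxc : x ∈ Subgroup.centralizer ((K : Subgroup Gfp) : Set Gfp) := by
      rw [Subgroup.mem_centralizer_iff]
      intro n hn
      have e := hP1 n hn
      rw [one_mul, inv_one, mul_one] at e
      have e' := hfinj _ (hKU (hKn n hn x)) _ (hKU hn) e
      calc n * x = x * n * x⁻¹ * x := by rw [e']
        _ = x * n := by group
    rw [isSlimGroup_gfp.centralizer_eq_bot K hKo] at hxc
    exact Subgroup.mem_bot.mp hxc
  -- `Φ⁻¹(dUU l) = dUU l`
  have hΦmem : ∀ x : Gfp, Φf x ∈ dUU l' → x ∈ dUU l' := by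
    intro x hx
    have e : Φf x = Φf (f' (Φf x)) := by
      rw [hΦU (f' (Φf x)) (hf'U _ hx), hff' _ hx]
    exact (hΦinj e : x = f' (Φf x)) ▸ hf'U _ hx
  have hΦsurj : Function.Surjective Φm := by
    haveI : (dUU l').FiniteIndex := ⟨index_dUU_ne_zero l'⟩
    let q : Gfp ⧸ dUU l' → Gfp ⧸ dUU l' :=
      Quotient.map' Φm fun a b hab => by
        rw [QuotientGroup.leftRel_apply] at hab ⊢
        rw [← map_inv, ← map_mul, hΦm, hΦU _ hab]
        exact hfU _ hab
    have hq : ∀ x : Gfp, q (x : Gfp ⧸ dUU l') = ((Φm x : Gfp) : Gfp ⧸ dUU l') := fun _ => rfl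
    have hqinj : Function.Injective q := by
      intro x y
      induction x using QuotientGroup.induction_on with
      | H a =>
        induction y using QuotientGroup.induction_on with
        | H b =>
          intro hab
          rw [hq, hq, QuotientGroup.eq, ← map_inv, ← map_mul] at hab
          exact QuotientGroup.eq.mpr (hΦmem _ hab)
    have hqsurj : Function.Surjective q := Finite.injective_iff_surjective.mp hqinj
    intro y
    obtain ⟨x, hx⟩ := hqsurj (y : Gfp ⧸ dUU l')
    induction x using QuotientGroup.induction_on with
    | H a =>
      rw [hq, QuotientGroup.eq] at hx
      refine ⟨a * f' ((Φm a)⁻¹ * y), ?_⟩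
      rw [map_mul, hΦm (f' _), hΦU _ (hf'U _ hx), hff' _ hx, mul_inv_cancel_left]
  /- Step 5: topology — `Φ` and `Φ⁻¹` agree with the continuous `f`, `f'` on the open subgroup `dUU l`. -/
  let Φe : Gfp ≃* Gfp := MulEquiv.ofBijective Φm ⟨hΦinj, hΦsurj⟩
  have hΦe : ∀ x, Φe x = Φf x := fun _ => rfl
  have hΦe' : ∀ e ∈ dUU l', Φe.symm e = f' e := fun e he => by
    apply Φe.injective
    rw [Φe.apply_symm_apply, hΦe, hΦU _ (hf'U e he), hff' e he]
  have hU1 : (dUU l' : Set Gfp) ∈ 𝓝 (1 : Gfp) := (isOpen_dUU l').mem_nhds (one_mem _)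
  have hcont : Continuous Φe := by
    apply continuous_of_continuousAt_one Φe
    have h1 : ContinuousAt f 1 := hfcont.continuousAt hU1
    refine h1.congr (Filter.mem_of_superset hU1 fun u hu => ?_)
    exact (hΦU u hu).symm
  have hcont' : Continuous Φe.symm := by
    apply continuous_of_continuousAt_one Φe.symm
    have h1 : ContinuousAt f' 1 := hf'cont.continuousAt hU1
    refine h1.congr (Filter.mem_of_superset hU1 fun u hu => ?_)
    exact (hΦe' u hu).symm
  refine ⟨{ Φe with continuous_toFun := hcont, continuous_invFun := hcont' }, hΦa, fun d hd => ?_⟩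
  change (SemidirectProduct.inl (Φf d) : PiTpχq p i j) = _
  rw [hΦU d hd, hfinl d hd]

end Literature.AnabelianGeometry.EtaleTheta.SettingModel

end
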